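import Summits.BirchSwinnertonDyer.BirchSwinnertonDyer.Theorems.SignedLowerHalvesSprungLowerDivisibilityAtThreeCokerBoundByMassSkeleton
import Literature.NumberTheory.EllipticCurves.Sprung2012.ColemanMapJointCokernelOfHondaProofs
import Literature.NumberTheory.EllipticCurves.Sprung2012.ColemanPairUniqueProofs
import Literature.NumberTheory.EllipticCurves.Sprung2012.SharpFlatSelmerDualInvolutionTwistProofs
import Literature.NumberTheory.EllipticCurves.Sprung2012.SharpFlatSelmerDualExistsProofs
import Literature.NumberTheory.EllipticCurves.Kato2004.IwasawaInvolutionTwistProofs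
import Literature.NumberTheory.EllipticCurves.IwasawaSelmerDualUniquenessProofs
import Literature.NumberTheory.EllipticCurves.Rank1Residual.Predicates
import HarnessLib

/-!
# Crux `SprungLowerDivisibilityAtThree` (item stmt-BirchSwinnertonDyer-19875; x8 children 22569 / 22901 / 22570 / 23112),
# line `chromatic-common-zeros`: «F-α♮ BY MASS», part 3 — (M1) is KEYING-IMMUNE (the `γ⁻¹`-keyed family implies the `γ`-keyed
# one, prime by mirror prime), and (M1) at one prime from a Poitou–Tate datum in the FUNCTIONAL MODEL of `H¹_Iw(ℚ_p,T)` with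
# the joint Coleman map supplied by the tree (the typer's exact target, over abstract `X, X₀, X♯, X♭` — any keying)

Cell `bsd-ssimc` (host), width seat `cruxlead-stmt-BirchSwinnertonDyer-19875-w2` (gen 9) under the 19875 LEAD; `--supports`
stmt-BirchSwinnertonDyer-22569 `--as helper`; theorems only; closes NO item. Companion of `…CokerBoundByMass` (p665043: the
registered stub F-α♮ ⟸ (MASS♮) ⟸ (M1) ∧ (M2)), `…CokerBoundByMassMatar` ((M2) by name from Matar 2020), `…CokerBoundByMassSkeleton`
(the module algebra of (M1)). HONEST FRAMING: nothing arithmetic is asserted; no Poitou–Tate datum is CONSTRUCTED here (that is the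
typed input still missing); K_spor, S4b-cyc, K1, leaf X8 and BSD are NOT proved by anything in this file.

* §1 `ι`-dictionary for the torsion of `X(E/K_∞)`: `lengthAt_torsion_eq_of_involSemilinear` (`ℓ_𝔓 tors(M^ι) = ℓ_{ι𝔓} tors M` for any
  `ι`-semilinear `M ≃+ N`), the `γ ↦ γ⁻¹` twist of a `SelmerDualData` (`selmerDualData_toDual_invol_one_add_X_smul`,
  `selmerDualData_exists_involTwist` — verbatim the fine/♯♭ constructions of `Kato2004/IwasawaInvolutionTwistProofs`,
  `Sprung2012/SharpFlatSelmerDualInvolutionTwistProofs`), and `selmerDualData_lengthAt_torsion_inv_eq`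
  (`ℓ_𝔓 tors S′.X = ℓ_{ι𝔓} tors S.X` for ANY `S` of key `γ`, `S′` of key `γ⁻¹`).
* §2 `massCotorsion_of_contraFamily` — (M1) for the `γ⁻¹`-keyed (print-keyed, `_contra`) family of pinned duals at every
  height-one `𝔭 ∌ p, T` ⟹ (M1) for the `γ`-keyed family (read the hypothesis at `ι𝔭`; `ι` preserves height one, `∌ p`, `∌ T`).
  So the typer may discharge (M1) in EITHER keying.
* §3 `min_lengthAt_le_fine_add_torsion_of_poitouTate_functionalModel` — (M1) AT ONE PRIME for ABSTRACT `Λ`-modules `X ↠ Y`,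
  `X ↠ D♯`, `X ↠ D♭` receiving a Poitou–Tate datum `loc : H → P`, `toX : P → X` in the tree's functional model
  `P = (E(ℚ_∞·ℚ_p) →+ ℤ_p)` (`Sprung2012.moduleOfGenerator`), with `ker πY = range toX` and `ker π• = toX(Ker Col^•)`
  (`Sprung2012.colemanKer`, Def. 7.9): the joint Coleman map, its injectivity and its cokernel `Λ/(T)` come from the tree
  (`Sprung2012.exists_linearMap_isColemanPair_cokernel_of_hondaSystem_rat`, w2 g8) and `Ker Col^• = ker(•-coordinate of J)` from
  `IsColemanPair.unique`. This is the exact shape the typer of Poitou–Tate (Kato (17.13.1); Kobayashi 2003 (7.18)–(7.20); Sprung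
  Def. 7.9/7.11/7.13 through Pontryagin duality) has to instantiate — nothing about `colMap`, no non-vanishing of either colour.

References: [Kato2004Asterisque] Thm. 12.4, (17.13.1); [Kobayashi2003] Prop. 7.1, (7.16)–(7.20), Thm. 7.3; [Sprung2012] Def. 7.9, 7.11,
7.13, §7.1; [KuriharaPollack2007] Prop. 1.2; [LeiSujatha2021] (SES-KP), (PT); [Greenberg1989] §0 (the module `S^ι`); [GreenbergLNM1716]
§1; [Washington1997] §13.2; tree: the three companions, `Sprung2012/{ColemanMapJointCokernelOfHondaProofs, ColemanPairUniqueProofs,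
ColemanMaps, SharpFlatSelmerDualInvolutionTwistProofs}`, `Kato2004/IwasawaInvolutionTwistProofs`, `IwasawaSelmerDualUniquenessProofs`.
-/

set_option linter.dupNamespace false
set_option autoImplicit false

noncomputable section

open scoped Classical NumberField

open NumberField IsDedekindDomain WeierstrassCurve Field
  Literature.NumberTheory.EllipticCurves Literature.NumberTheory.EllipticCurves.ZpExtension
  Literature.NumberTheory.EllipticCurves.Sprung2017 Literature.NumberTheory.EllipticCurves.Sprung2012
  Literature.NumberTheory.EllipticCurves.Rank1Residual Literature.NumberTheory.EllipticCurves.IwasawaAlgebra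
  Literature.NumberTheory.EllipticCurves.Kato2004 Literature.NumberTheory.EllipticCurves.Module

namespace Summit.BirchSwinnertonDyer.BirchSwinnertonDyer.Theorems.ChromaticCommonZeros

universe u

/-! ### §1 The `ι`-dictionary for torsion submodules and the `γ ↦ γ⁻¹` twist of `X(E/K_∞)` -/

section TorsionTwist

variable {p : ℕ} [Fact p.Prime] {M : Type*} [AddCommGroup M] [Module (IwasawaAlgebra p) M]
  {N : Type*} [AddCommGroup N] [Module (IwasawaAlgebra p) N]

/-- An `ι`-semilinear additive equivalence `e : M ≃+ N` (`e(f·m) = ι(f)·e(m)`) restricts to an `ι`-semilinear additive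
equivalence of the `Λ`-torsion submodules (`ι` preserves non-zero-divisors), so **`ℓ_𝔓 tors N = ℓ_{ι𝔓} tors M`**.
[cite: Greenberg1989, §0 pp. 101–102] [cite: Washington1997, §13.2] -/
theorem lengthAt_torsion_eq_of_involSemilinear (e : M ≃+ N)
    (he : ∀ (f : IwasawaAlgebra p) (m : M), e (f • m) = invol p f • e m) (𝔓 : PrimeSpectrum (IwasawaAlgebra p)) :
    Module.lengthAt (IwasawaAlgebra p) (Submodule.torsion (IwasawaAlgebra p) N) 𝔓 =
      Module.lengthAt (IwasawaAlgebra p) (Submodule.torsion (IwasawaAlgebra p) M)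
        (PrimeSpectrum.comap (invol p).toRingHom 𝔓) := by
  have he' : ∀ (f : IwasawaAlgebra p) (n : N), e.symm (f • n) = invol p f • e.symm n := by
    intro f n
    apply e.injective
    rw [e.apply_symm_apply, he, invol_invol, e.apply_symm_apply]
  have hto : ∀ m ∈ Submodule.torsion (IwasawaAlgebra p) M, e m ∈ Submodule.torsion (IwasawaAlgebra p) N := by
    intro m hm
    obtain ⟨⟨a, ha⟩, ham⟩ := (Submodule.mem_torsion_iff m).mp hm
    refine (Submodule.mem_torsion_iff _).mpr ⟨⟨invol p a, invol_mem_nonZeroDivisors ha⟩, ?_⟩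
    change invol p a • e m = 0
    rw [← he, show a • m = 0 from ham, map_zero]
  have hfrom : ∀ n ∈ Submodule.torsion (IwasawaAlgebra p) N, e.symm n ∈ Submodule.torsion (IwasawaAlgebra p) M := by
    intro n hn
    obtain ⟨⟨a, ha⟩, han⟩ := (Submodule.mem_torsion_iff n).mp hn
    refine (Submodule.mem_torsion_iff _).mpr ⟨⟨invol p a, invol_mem_nonZeroDivisors ha⟩, ?_⟩
    change invol p a • e.symm n = 0
    rw [← he', show a • n = 0 from han, map_zero]
  set eT : Submodule.torsion (IwasawaAlgebra p) M ≃+ Submodule.torsion (IwasawaAlgebra p) N :=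
    { toFun := fun m => ⟨e m, hto m m.2⟩
      invFun := fun n => ⟨e.symm n, hfrom n n.2⟩
      left_inv := fun m => Subtype.ext (e.symm_apply_apply m)
      right_inv := fun n => Subtype.ext (e.apply_symm_apply n)
      map_add' := fun m m' => Subtype.ext (e.map_add m m') } with heT
  have heT' : ∀ (f : IwasawaAlgebra p) (m : Submodule.torsion (IwasawaAlgebra p) M), eT (f • m) = invol p f • eT m :=
    fun f m => Subtype.ext (he f m)
  exact Kato2004.lengthAt_eq_of_involSemilinear eT heT' 𝔓

variable {K : Type u} [Field K] [NumberField K] {W : WeierstrassCurve K} {κ : ZpExtension K p}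
  {γ δ : Field.absoluteGaloisGroup K}

/-- In `S : W.SelmerDualData κ γ` the unit `ι(1 + T)` acts as `x ↦ x ∘ conj_δ` for `γ δ = 1` (`(1 + T)` acts as `x ↦ x ∘ conj_γ`
and `conj` is an action) — verbatim the fine version `Kato2004.fineSelmerDualData_toDual_invol_one_add_X_smul`.
[cite: GreenbergLNM1716, §1 p. 60] -/
theorem selmerDualData_toDual_invol_one_add_X_smul (hγδ : γ * δ = 1) (S : W.SelmerDualData κ γ) (x : S.X)
    (s : W.selmerInfty κ) :
    S.toDual (invol p (1 + PowerSeries.X) • x) s = S.toDual x (W.conjSelmerInfty κ δ s) := by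
  set y : S.X := invol p (1 + PowerSeries.X) • x with hy
  have hx : x = (1 + PowerSeries.X : IwasawaAlgebra p) • y := by
    rw [hy, ← mul_smul, one_add_X_mul_invol_one_add_X p, one_smul]
  have h1 : ∀ s' : W.selmerInfty κ, S.toDual ((1 + PowerSeries.X : IwasawaAlgebra p) • y) s' =
      S.toDual y ⟨W.conjH1 p κ.kerSubgroup γ s', S.conj_mem s' s'.2⟩ := by
    intro s'
    rw [add_smul, one_smul, map_add, AddMonoidHom.add_apply, S.toDual_T_smul, add_sub_cancel]
  conv_rhs => rw [hx, h1]
  congr 1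
  apply Subtype.ext
  change (s : W.subgroupH1 p κ.kerSubgroup) =
    W.conjH1 p κ.kerSubgroup γ (W.conjH1 p κ.kerSubgroup δ (s : W.subgroupH1 p κ.kerSubgroup))
  rw [← AddMonoidHom.comp_apply, ← W.conjH1_mul_holds p κ.kerSubgroup γ δ, hγδ,
    W.conjH1_one_holds p κ.kerSubgroup, AddMonoidHom.id_apply]

/-- **The `γ ↦ δ = γ⁻¹` twist of a Pontryagin-dual datum of `Sel_{p^∞}(E/K_∞)` is its `ι`-twist**: for `γ δ = 1` and
`S : W.SelmerDualData κ γ` there is `S' : W.SelmerDualData κ δ` on the same character group with the `Λ`-structure twisted by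
`ι` (an `ι`-semilinear `e : S.X ≃+ S'.X` over `toDual`) — verbatim `Kato2004.fineSelmerDualData_exists_involTwist`.
[cite: GreenbergLNM1716, §1 p. 60] [cite: Greenberg1989, §0 pp. 101–102] -/
theorem selmerDualData_exists_involTwist (hγδ : γ * δ = 1) (S : W.SelmerDualData κ γ) :
    ∃ (S' : W.SelmerDualData κ δ) (e : S.X ≃+ S'.X),
      (∀ (f : IwasawaAlgebra p) (x : S.X), e (f • x) = invol p f • e x) ∧
      ∀ x : S.X, S'.toDual (e x) = S.toDual x := by
  refine ⟨@WeierstrassCurve.SelmerDualData.mk K _ _ W p _ κ δ S.X S.addCommGroup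
      (Module.compHom S.X (invol p).toRingHom)
      (fun s hs ↦ W.map_conjH1_selmerGroupOver_le_holds p κ.kerSubgroup δ ⟨s, hs, rfl⟩)
      S.toDual S.bijective ?_ ?_,
    AddEquiv.refl S.X, ?_, ?_⟩
  · intro x s
    change S.toDual (invol p PowerSeries.X • x) s = _
    have hX : invol p (PowerSeries.X : IwasawaAlgebra p) = invol p (1 + PowerSeries.X) - 1 := by
      rw [map_add, map_one, add_sub_cancel_left]
    rw [hX, sub_smul, one_smul, map_sub, AddMonoidHom.sub_apply, selmerDualData_toDual_invol_one_add_X_smul hγδ S x s]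
    rfl
  · intro c x s k hk
    change S.toDual (invol p (PowerSeries.C c) • x) s = _
    rw [invol_C]
    exact S.toDual_C_smul c x s k hk
  · intro f x
    change f • x = invol p (invol p f) • x
    rw [invol_invol]
  · intro x
    rfl

/-- **`ℓ_𝔓(tors S′.X) = ℓ_{ι𝔓}(tors S.X)` for ANY Pontryagin-dual data `S` of key `γ` and `S′` of key `γ⁻¹` of `Sel_{p^∞}(E/K_∞)`**
(the twisted datum has these lengths by `lengthAt_torsion_eq_of_involSemilinear`; any two data of key `γ⁻¹` are `Λ`-isomorphic,
`SelmerDualData.exists_linearEquiv`, and isomorphisms identify torsion submodules). The `X(E/K_∞)`-twin of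
`Kato2004.fineSelmerDualData_lengthAt_inv_eq` / `Sprung2012.sharpFlatSelmerDualData_lengthAt_inv_eq`.
[cite: GreenbergLNM1716, §1 p. 60] [cite: Greenberg1989, §0 pp. 101–102] -/
theorem selmerDualData_lengthAt_torsion_inv_eq (S : W.SelmerDualData κ γ) (S' : W.SelmerDualData κ γ⁻¹)
    (𝔓 : PrimeSpectrum (IwasawaAlgebra p)) :
    Module.lengthAt (IwasawaAlgebra p) (Submodule.torsion (IwasawaAlgebra p) S'.X) 𝔓 =
      Module.lengthAt (IwasawaAlgebra p) (Submodule.torsion (IwasawaAlgebra p) S.X)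
        (PrimeSpectrum.comap (invol p).toRingHom 𝔓) := by
  obtain ⟨S₁, e, he, -⟩ := selmerDualData_exists_involTwist (mul_inv_cancel γ) S
  obtain ⟨e', -⟩ := WeierstrassCurve.SelmerDualData.exists_linearEquiv S' S₁
  rw [lengthAt_torsion_eq_of_linearEquiv e' 𝔓, lengthAt_torsion_eq_of_involSemilinear e he 𝔓]

end TorsionTwist

/-! ### §2 (M1) is keying-immune: the `γ⁻¹`-keyed family implies the `γ`-keyed family -/

section Keying

/-- `p ∉ ι𝔭` and `T ∉ ι𝔭` when `p ∉ 𝔭`, `T ∉ 𝔭` (`ι` fixes constants; `ι(T)·(1+T) = −T`). [folklore] -/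
private theorem natCast_not_mem_and_X_not_mem_comap_invol {p : ℕ} [Fact p.Prime]
    (𝔭 : PrimeSpectrum (IwasawaAlgebra p)) (hp𝔭 : (p : IwasawaAlgebra p) ∉ 𝔭.asIdeal)
    (hT𝔭 : (PowerSeries.X : IwasawaAlgebra p) ∉ 𝔭.asIdeal) :
    (p : IwasawaAlgebra p) ∉ (PrimeSpectrum.comap (invol p).toRingHom 𝔭).asIdeal ∧
      (PowerSeries.X : IwasawaAlgebra p) ∉ (PrimeSpectrum.comap (invol p).toRingHom 𝔭).asIdeal := by
  constructor
  · rw [PrimeSpectrum.comap_asIdeal, Ideal.mem_comap, ← map_natCast (PowerSeries.C (R := ℤ_[p])) p]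
    change invol p (PowerSeries.C (p : ℤ_[p])) ∉ 𝔭.asIdeal
    rw [invol_C, map_natCast]
    exact hp𝔭
  · rw [PrimeSpectrum.comap_asIdeal, Ideal.mem_comap]
    change invol p PowerSeries.X ∉ 𝔭.asIdeal
    have hu : IsUnit (1 + PowerSeries.X : IwasawaAlgebra p) := by
      rw [PowerSeries.isUnit_iff_constantCoeff, map_add, map_one, PowerSeries.constantCoeff_X, add_zero]
      exact isUnit_one
    rw [← Ideal.mul_unit_mem_iff_mem 𝔭.asIdeal hu, invol_X_mul_one_add_X, neg_mem_iff]
    exact hT𝔭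

/-- **(M1) IS KEYING-IMMUNE.** If «`min(ℓ_𝔭 X♯, ℓ_𝔭 X♭) ≤ ℓ_𝔭 X₀ + ℓ_𝔭 tors X(E/ℚ_∞)`» holds at every height-one `𝔭 ∌ p, T` for the
`γ⁻¹`-keyed (print-keyed, `_contra`) pinned dual data `S′, Ds′, Df′, Y′`, then it holds for the `γ`-keyed data `S, Ds, Df, Y`:
read the hypothesis at the mirror prime `ι𝔭` (height one, `∌ p`, `∌ T`) and move every length across `ι`
(`sharpFlatSelmerDualData_lengthAt_inv_eq`, `fineSelmerDualData_lengthAt_inv_eq`, `selmerDualData_lengthAt_torsion_inv_eq`, `ι² = 1`).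
Hence the typer of the Poitou–Tate input may work in either convention. [cite: Greenberg1989, §0 pp. 101–102]
[cite: GreenbergLNM1716, §1 p. 60] [cite: Kato2004Asterisque, (17.13.1) (p. 279)] -/
theorem massCotorsion_of_contraFamily
    (hM1' : ∀ (W : WeierstrassCurve ℚ) [W.IsElliptic] [W.IsGloballyMinimal] (p : ℕ) [Fact p.Prime],
      ClassX8 W p → ∀ (κ : ZpExtension ℚ p) (γ : Field.absoluteGaloisGroup ℚ),
      κ.IsCyclotomic → κ.IsTopGenerator γ →
    ∀ (v : HeightOneSpectrum (𝓞 ℚ)), (p : 𝓞 ℚ) ∈ v.asIdeal →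
    ∀ (g : Field.absoluteGaloisGroup (v.adicCompletion ℚ)),
      κ.IsTopGenerator (resGalOfEmb (closureEmb (K := ℚ) (v.adicCompletion ℚ)) g) →
    ∀ (cneg : localPoints W (v.adicCompletion ℚ)) (c : ℕ → localPoints W (v.adicCompletion ℚ)),
      IsHondaSystem κ (closureEmb (K := ℚ) (v.adicCompletion ℚ)) W (W.frobeniusTrace p) g cneg c →
    ∀ (S' : W.SelmerDualData κ γ⁻¹)
      (Ds' : SharpFlatSelmerDualData W κ γ⁻¹ (closureEmb (K := ℚ) (v.adicCompletion ℚ)) (W.frobeniusTrace p) g c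
        Chroma.sharp)
      (Df' : SharpFlatSelmerDualData W κ γ⁻¹ (closureEmb (K := ℚ) (v.adicCompletion ℚ)) (W.frobeniusTrace p) g c
        Chroma.flat)
      (Y' : W.FineSelmerDualData κ γ⁻¹) (𝔭 : PrimeSpectrum (IwasawaAlgebra p)), 𝔭.asIdeal.height = 1 →
      (p : IwasawaAlgebra p) ∉ 𝔭.asIdeal → (PowerSeries.X : IwasawaAlgebra p) ∉ 𝔭.asIdeal →
      min (Module.lengthAt (IwasawaAlgebra p) Ds'.X 𝔭) (Module.lengthAt (IwasawaAlgebra p) Df'.X 𝔭) ≤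
        Module.lengthAt (IwasawaAlgebra p) Y'.X 𝔭 +
          Module.lengthAt (IwasawaAlgebra p) (Submodule.torsion (IwasawaAlgebra p) S'.X) 𝔭) :
    ∀ (W : WeierstrassCurve ℚ) [W.IsElliptic] [W.IsGloballyMinimal] (p : ℕ) [Fact p.Prime],
      ClassX8 W p → ∀ (κ : ZpExtension ℚ p) (γ : Field.absoluteGaloisGroup ℚ),
      κ.IsCyclotomic → κ.IsTopGenerator γ →
    ∀ (v : HeightOneSpectrum (𝓞 ℚ)), (p : 𝓞 ℚ) ∈ v.asIdeal →
    ∀ (g : Field.absoluteGaloisGroup (v.adicCompletion ℚ)),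
      κ.IsTopGenerator (resGalOfEmb (closureEmb (K := ℚ) (v.adicCompletion ℚ)) g) →
    ∀ (cneg : localPoints W (v.adicCompletion ℚ)) (c : ℕ → localPoints W (v.adicCompletion ℚ)),
      IsHondaSystem κ (closureEmb (K := ℚ) (v.adicCompletion ℚ)) W (W.frobeniusTrace p) g cneg c →
    ∀ (S : W.SelmerDualData κ γ)
      (Ds : SharpFlatSelmerDualData W κ γ (closureEmb (K := ℚ) (v.adicCompletion ℚ)) (W.frobeniusTrace p) g c
        Chroma.sharp)
      (Df : SharpFlatSelmerDualData W κ γ (closureEmb (K := ℚ) (v.adicCompletion ℚ)) (W.frobeniusTrace p) g c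
        Chroma.flat)
      (Y : W.FineSelmerDualData κ γ) (𝔭 : PrimeSpectrum (IwasawaAlgebra p)), 𝔭.asIdeal.height = 1 →
      (p : IwasawaAlgebra p) ∉ 𝔭.asIdeal → (PowerSeries.X : IwasawaAlgebra p) ∉ 𝔭.asIdeal →
      min (Module.lengthAt (IwasawaAlgebra p) Ds.X 𝔭) (Module.lengthAt (IwasawaAlgebra p) Df.X 𝔭) ≤
        Module.lengthAt (IwasawaAlgebra p) Y.X 𝔭 +
          Module.lengthAt (IwasawaAlgebra p) (Submodule.torsion (IwasawaAlgebra p) S.X) 𝔭 := by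
  intro W _ _ p _ hX κ γ hκ hγ v hv g hg cneg c hH S Ds Df Y 𝔭 h𝔭 hp𝔭 hT𝔭
  -- `γ⁻¹`-keyed companions
  obtain ⟨S', -, -, -⟩ := selmerDualData_exists_involTwist (mul_inv_cancel γ) S
  obtain ⟨Ds'⟩ := nonempty_sharpFlatSelmerDualData' W κ (closureEmb (K := ℚ) (v.adicCompletion ℚ))
    (W.frobeniusTrace p) g c Chroma.sharp γ⁻¹
  obtain ⟨Df'⟩ := nonempty_sharpFlatSelmerDualData' W κ (closureEmb (K := ℚ) (v.adicCompletion ℚ))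
    (W.frobeniusTrace p) g c Chroma.flat γ⁻¹
  obtain ⟨Y', -, -, -⟩ := Kato2004.fineSelmerDualData_exists_involTwist (mul_inv_cancel γ) Y
  -- the mirror prime
  set 𝔮 : PrimeSpectrum (IwasawaAlgebra p) := PrimeSpectrum.comap (invol p).toRingHom 𝔭 with h𝔮
  have h𝔮1 : 𝔮.asIdeal.height = 1 := (Kato2004.height_comap_invol 𝔭).trans h𝔭
  obtain ⟨hp𝔮, hT𝔮⟩ := natCast_not_mem_and_X_not_mem_comap_invol 𝔭 hp𝔭 hT𝔭
  have h := hM1' W p hX κ γ hκ hγ v hv g hg cneg c hH S' Ds' Df' Y' 𝔮 h𝔮1 hp𝔮 hT𝔮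
  rwa [h𝔮, sharpFlatSelmerDualData_lengthAt_inv_eq Ds Ds', sharpFlatSelmerDualData_lengthAt_inv_eq Df Df',
    Kato2004.fineSelmerDualData_lengthAt_inv_eq Y Y', selmerDualData_lengthAt_torsion_inv_eq S S',
    Kato2004.comap_invol_comap_invol] at h

end Keying

/-! ### §3 (M1) at one prime from a Poitou–Tate datum in the functional model (the typer's target) -/

section FunctionalModel

universe v₁ v₂ v₃ v₄ v₅

/-- **(M1) AT ONE PRIME FROM A POITOU–TATE DATUM IN THE FUNCTIONAL MODEL OF `H¹_Iw(ℚ_p,T)`.** `W/ℚ` globally minimal, `p ≠ 2` good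
supersingular, `κ` a `ℤ_p`-extension, `v ∋ p`, `g` a local lift of the topological generator, `(c₋₁, c)` a Honda system; `P` the
functional model `E(ℚ_∞·ℚ_p) →+ ℤ_p` with `Λ`-structure `moduleOfGenerator`. GIVEN over ABSTRACT `Λ`-modules (any keying):
`H = Λ·h₀` (Kato's `𝐇¹`, Thm. 12.4 (3)), `loc : H → P` with `loc h₀ ≠ 0` and `toX : P → X` exact at `P` (Poitou–Tate, Kato (17.13.1) /
Kobayashi Prop. 7.1, Thm. 7.3), `πY : X ↠ Y` with `ker πY = range toX` (`X₀` = `X` modulo the local classes, Kobayashi (7.18) /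
Sprung Def. 7.13), `π• : X ↠ D•` with `ker π• = toX(Ker Col^•)` (`Sprung2012.colemanKer`, Def. 7.9 / 7.11 read through Pontryagin
duality) — THEN at every height-one `𝔭 ∌ T`: `min(ℓ_𝔭 D♯, ℓ_𝔭 D♭) ≤ ℓ_𝔭 Y + ℓ_𝔭(tors X)`. The joint Coleman map, its injectivity,
`ℓ_𝔭(Λ²/im J) = 0` and `Ker Col^• = ker(• ∘ J)` are supplied by the tree (`exists_linearMap_isColemanPair_cokernel_of_hondaSystem_rat`,
`IsColemanPair.unique`); the algebra is `min_lengthAt_le_fine_add_torsion_of_massSkeleton`.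
[cite: Kato2004Asterisque, Thm. 12.4 (p. 221), (17.13.1) (pp. 279–280)] [cite: Kobayashi2003, Prop. 7.1, (7.16)–(7.20), Thm. 7.3 (pp. 12–13)]
[cite: Sprung2012, Def. 5.9 (p. 1495), Def. 7.1, Props. 7.3/7.6 (pp. 1500–1501), Def. 7.9, 7.11 (p. 1503), Def. 7.13 (p. 1504)]
[cite: KuriharaPollack2007, Prop. 1.2] [cite: LeiSujatha2021, (SES-KP), (PT)] -/
theorem min_lengthAt_le_fine_add_torsion_of_poitouTate_functionalModel
    (W : WeierstrassCurve ℚ) [W.IsElliptic] [W.IsGloballyMinimal] (p : ℕ) [Fact p.Prime] (hp2 : p ≠ 2)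
    (hgood : W.HasGoodReductionAtPrime p) (hap : (p : ℤ) ∣ W.frobeniusTrace p) (κ : ZpExtension ℚ p)
    {v : HeightOneSpectrum (𝓞 ℚ)} (hpv : (p : 𝓞 ℚ) ∈ v.asIdeal)
    {g : Field.absoluteGaloisGroup (v.adicCompletion ℚ)}
    (hg : κ.IsTopGenerator (resGalOfEmb (closureEmb (K := ℚ) (v.adicCompletion ℚ)) g))
    {cneg : localPoints W (v.adicCompletion ℚ)} {c : ℕ → localPoints W (v.adicCompletion ℚ)}
    (hH : IsHondaSystem κ (closureEmb (K := ℚ) (v.adicCompletion ℚ)) W (W.frobeniusTrace p) g cneg c) :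
    letI := moduleOfGenerator κ (closureEmb (K := ℚ) (v.adicCompletion ℚ)) W hg
    ∀ {H : Type v₁} {X : Type v₂} {Y : Type v₃} {Ds : Type v₄} {Df : Type v₅}
      [AddCommGroup H] [Module (IwasawaAlgebra p) H] [AddCommGroup X] [Module (IwasawaAlgebra p) X]
      [AddCommGroup Y] [Module (IwasawaAlgebra p) Y] [AddCommGroup Ds] [Module (IwasawaAlgebra p) Ds]
      [AddCommGroup Df] [Module (IwasawaAlgebra p) Df]
      (loc : H →ₗ[IwasawaAlgebra p]
        (localTowerPointsOfEmb κ (closureEmb (K := ℚ) (v.adicCompletion ℚ)) W →+ ℤ_[p]))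
      (toX : (localTowerPointsOfEmb κ (closureEmb (K := ℚ) (v.adicCompletion ℚ)) W →+ ℤ_[p]) →ₗ[IwasawaAlgebra p] X),
      Function.Exact loc toX →
    ∀ (πY : X →ₗ[IwasawaAlgebra p] Y), Function.Surjective πY → LinearMap.ker πY = LinearMap.range toX →
    ∀ (πs : X →ₗ[IwasawaAlgebra p] Ds), Function.Surjective πs →
      (∀ x, x ∈ LinearMap.ker πs ↔
        x ∈ toX '' colemanKer κ (closureEmb (K := ℚ) (v.adicCompletion ℚ)) W (W.frobeniusTrace p) g c Chroma.sharp) →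
    ∀ (πf : X →ₗ[IwasawaAlgebra p] Df), Function.Surjective πf →
      (∀ x, x ∈ LinearMap.ker πf ↔
        x ∈ toX '' colemanKer κ (closureEmb (K := ℚ) (v.adicCompletion ℚ)) W (W.frobeniusTrace p) g c Chroma.flat) →
    ∀ (h₀ : H), (∀ h : H, ∃ r : IwasawaAlgebra p, r • h₀ = h) → loc h₀ ≠ 0 →
    ∀ (𝔭 : PrimeSpectrum (IwasawaAlgebra p)), 𝔭.asIdeal.height = 1 →
      (PowerSeries.X : IwasawaAlgebra p) ∉ 𝔭.asIdeal →
      min (Module.lengthAt (IwasawaAlgebra p) Ds 𝔭) (Module.lengthAt (IwasawaAlgebra p) Df 𝔭) ≤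
        Module.lengthAt (IwasawaAlgebra p) Y 𝔭 +
          Module.lengthAt (IwasawaAlgebra p) (Submodule.torsion (IwasawaAlgebra p) X) 𝔭 := by
  letI := moduleOfGenerator κ (closureEmb (K := ℚ) (v.adicCompletion ℚ)) W hg
  intro H X Y Ds Df _ _ _ _ _ _ _ _ _ _ loc toX hexact πY hπY hkerY πs hπs hkers πf hπf hkerf h₀ hcyc hloc 𝔭 h𝔭 hT
  obtain ⟨J, hJ, hinj, -, hcoker⟩ :=
    exists_linearMap_isColemanPair_cokernel_of_hondaSystem_rat W p hp2 hgood hap κ hpv hg hH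
  -- `Ker Col^• = ker(• ∘ J)` by uniqueness of Coleman values
  have hker : ∀ (col : Chroma) (z : localTowerPointsOfEmb κ (closureEmb (K := ℚ) (v.adicCompletion ℚ)) W →+ ℤ_[p]),
      z ∈ colemanKer κ (closureEmb (K := ℚ) (v.adicCompletion ℚ)) W (W.frobeniusTrace p) g c col ↔
        chromaticL col (J z).1 (J z).2 = 0 := by
    intro col z
    rw [mem_colemanKer_iff]
    constructor
    · rintro ⟨Ls, Lf, hz, h0⟩
      obtain ⟨h1, h2⟩ := IsColemanPair.unique κ (closureEmb (K := ℚ) (v.adicCompletion ℚ)) W hap hz (hJ z)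
      rwa [h1, h2] at h0
    · intro h0
      exact ⟨(J z).1, (J z).2, hJ z, h0⟩
  have hkers' : LinearMap.ker πs = (LinearMap.ker (LinearMap.fst _ _ _ ∘ₗ J)).map toX := by
    ext x
    rw [hkers x, Submodule.mem_map]
    constructor
    · rintro ⟨z, hz, rfl⟩
      refine ⟨z, ?_, rfl⟩
      rw [LinearMap.mem_ker, LinearMap.comp_apply, LinearMap.fst_apply]
      simpa only [chromaticL_sharp] using (hker Chroma.sharp z).mp hz
    · rintro ⟨z, hz, rfl⟩
      refine ⟨z, ?_, rfl⟩
      rw [LinearMap.mem_ker, LinearMap.comp_apply, LinearMap.fst_apply] at hz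
      exact (hker Chroma.sharp z).mpr (by simpa only [chromaticL_sharp] using hz)
  have hkerf' : LinearMap.ker πf = (LinearMap.ker (LinearMap.snd _ _ _ ∘ₗ J)).map toX := by
    ext x
    rw [hkerf x, Submodule.mem_map]
    constructor
    · rintro ⟨z, hz, rfl⟩
      refine ⟨z, ?_, rfl⟩
      rw [LinearMap.mem_ker, LinearMap.comp_apply, LinearMap.snd_apply]
      simpa only [chromaticL_flat] using (hker Chroma.flat z).mp hz
    · rintro ⟨z, hz, rfl⟩
      refine ⟨z, ?_, rfl⟩
      rw [LinearMap.mem_ker, LinearMap.comp_apply, LinearMap.snd_apply] at hz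
      exact (hker Chroma.flat z).mpr (by simpa only [chromaticL_flat] using hz)
  exact min_lengthAt_le_fine_add_torsion_of_massSkeleton loc toX hexact J hinj πY hπY hkerY πs hπs hkers' πf hπf hkerf'
    h₀ hcyc hloc 𝔭 h𝔭 (hcoker 𝔭 hT)

end FunctionalModel

end Summit.BirchSwinnertonDyer.BirchSwinnertonDyer.Theorems.ChromaticCommonZeros

end
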